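import Literature.Combinatorics.SimpleGraph.InvariantOrientation           -- ★ row 30b (generic): `exists_orientation_lt_of_adj`, `orientation_eq_of_lt`, `head_mapEdgeSet_eq_of_strictMono`, `incMatrix_map_mapEdgeSet_of_head_mapEdgeSet_eq`
import Literature.NumberTheory.Automorphic.UnitaryLatticeTreeNoInversion   -- ★ row 30 (model): no inversion on `latticeGraph`; brings ★ Apartment (`type_of_lt_three`) and ★ T1a Defs
import HarnessLib

/-!
# The canonical `U(σ, H)`-invariant orientation of the lattice graph «small lattice → big lattice»; equivariance of its incidence matrix
# (Bruhat–Tits 1972 §10; Serre, *Trees* I.3.1, II.1; Schneider–Stuhler 1997 III.4)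

Topic `NumberTheory/Automorphic`; namespace `Literature.NumberTheory.Automorphic.UnitaryLatticeTree` (★ T1a's).  THEOREMS ONLY (no definition, no instance, no notation, no named
fact, no `sorry`).  Cell `pub/hodgecm-mathlib` (D-0151), crux H413 = `stmt-HodgeConjecture-24833`; E1 BRICK LEDGER row 30b, MODEL half (keeper F0P3a-p03 (g29) «=»
2026-09-03T01:25:37Z).  HONEST LABEL: count-neutral generic base layer (the oriented (R-SS) chain complex on the `U(Φ₃)` tree as a complex of `G`-modules, no signs); HC_CM is proved
only modulo the 2 remaining named inputs (hLiu418 24832, h413 24833) until rung 0 closes; nothing printed is asserted here.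

THE MATHEMATICS.  In ★ `latticeGraph σ ϖ H` adjacent vertices are strictly comparable lattices (★ `latticeGraph_adj_iff`), so ★ row 30b §2 applies with the subtype order:
there is a UNIQUE orientation `τ` with `tail e < head e` (as lattices) on every edge (§1), every `u ∈ U(σ, H)` preserves it — `head (u·e) = u·(head e)`, `tail (u·e) = u·(tail e)`
— because `u` preserves strict inclusion (★ `mapGL_lt_mapGL_iff`) (§2), and consequently the incidence matrix ∕ boundary of the cellular chain complex is `U(σ, H)`-EQUIVARIANT:
`D_{u·v, u·e} = D_{v, e}` over any ring, `orientSign ≡ 1` (§3).  At `N = 3` over a unimodular form the tail of every edge is the type-two vertex and the head the self-dual one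
(★ `type_of_lt_three`) (§4).

* §1 `exists_orientation_latticeGraph`, `orientation_latticeGraph_eq`.
* §2 **`head_mapEdgeSet_latticeGraphIso`** (head and tail are `U(σ, H)`-equivariant).
* §3 `orientSign_latticeGraphIso_eq_one`, **`incMatrix_latticeGraphIso`**, and the package **`exists_invariant_orientation_latticeGraph`**.
* §4 `type_tail_head_three` (`N = 3`: tail type `2`, head type `0`).

## References
* [BruhatTits1972] F. Bruhat, J. Tits, *Groupes réductifs sur un corps local I*, Publ. Math. IHÉS 41 (1972), §10.
* [Serre1980Trees] J.-P. Serre, *Trees* (1980), Ch. I §3.1, Ch. II §1.1.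
* [SchneiderStuhler1997] P. Schneider, U. Stuhler, *Representation theory and sheaves on the Bruhat–Tits building*, Publ. Math. IHÉS 85 (1997), III.4.
-/

set_option autoImplicit false

noncomputable section

open scoped Valued WithZero Matrix MatrixGroups

namespace Literature.NumberTheory.Automorphic.UnitaryLatticeTree

open Literature.NumberTheory.Automorphic Literature.NumberTheory.Automorphic.HermitianLattice
open Literature.Combinatorics.SimpleGraph Literature.Combinatorics.SimpleGraph.OrientedIncidence Literature.Combinatorics.SimpleGraph.BakerNorine

variable {K : Type*} [Field K] [Valued K ℤᵐ⁰] {N : ℕ} (σ : K →+* K) (ϖ : K) (H : Matrix (Fin N) (Fin N) K)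

/-! ## §1 The canonical orientation «small lattice → big lattice» -/

/-- **The lattice graph carries an orientation with `tail e < head e` (as lattices) on every edge.** [cite: BruhatTits1972, §10] [cite: Serre1980Trees, II.1.1] -/
theorem exists_orientation_latticeGraph : ∃ τ : Orientation (latticeGraph σ ϖ H), ∀ e, τ.tail e < τ.head e :=
  NoInversion.exists_orientation_lt_of_adj fun v w h =>
    ((latticeGraph_adj_iff σ ϖ H v w).1 h).imp Subtype.coe_lt_coe.1 Subtype.coe_lt_coe.1

/-- … and it is unique. [cite: BruhatTits1972, §10] -/
theorem orientation_latticeGraph_eq {τ τ' : Orientation (latticeGraph σ ϖ H)} (hτ : ∀ e, τ.tail e < τ.head e) (hτ' : ∀ e, τ'.tail e < τ'.head e) : τ = τ' :=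
  NoInversion.orientation_eq_of_lt hτ hτ'

/-! ## §2 `U(σ, H)` preserves it -/

/-- **Head and tail of the canonical orientation are `U(σ, H)`-EQUIVARIANT**: `head (u·e) = u·(head e)`, `tail (u·e) = u·(tail e)`. [cite: BruhatTits1972, §10] [cite: Serre1980Trees, I.3.1] -/
theorem head_mapEdgeSet_latticeGraphIso {τ : Orientation (latticeGraph σ ϖ H)} (hτ : ∀ e, τ.tail e < τ.head e) (u : unitaryGroupOfForm σ H)
    (e : (latticeGraph σ ϖ H).edgeSet) :
    τ.head ((latticeGraphIso σ ϖ H u).mapEdgeSet e) = latticeGraphIso σ ϖ H u (τ.head e) ∧ τ.tail ((latticeGraphIso σ ϖ H u).mapEdgeSet e) = latticeGraphIso σ ϖ H u (τ.tail e) :=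
  NoInversion.head_mapEdgeSet_eq_of_strictMono hτ (latticeGraphIso σ ϖ H u)
    (fun v w _ h => Subtype.coe_lt_coe.1 ((mapGL_lt_mapGL_iff (u : GL (Fin N) K) v.1 w.1).2 (Subtype.coe_lt_coe.2 h))) e

/-! ## §3 Equivariance of the incidence matrix; the package -/

/-- Along the canonical orientation every `u ∈ U(σ, H)` has ★ `orientSign ≡ 1`. [cite: SchneiderStuhler1997, III.4] -/
theorem orientSign_latticeGraphIso_eq_one [DecidableEq {M : Submodule 𝒪[K] (Fin N → K) // IsVertex σ ϖ H M}] (F : Type*) [Field F]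
    {τ : Orientation (latticeGraph σ ϖ H)} (hτ : ∀ e, τ.tail e < τ.head e) (u : unitaryGroupOfForm σ H) (e : (latticeGraph σ ϖ H).edgeSet) :
    orientSign τ F (latticeGraphIso σ ϖ H u) e = 1 :=
  NoInversion.orientSign_eq_one_of_head_mapEdgeSet_eq τ _ F (fun e => (head_mapEdgeSet_latticeGraphIso σ ϖ H hτ u e).1) e

/-- **The incidence matrix of the lattice graph is `U(σ, H)`-EQUIVARIANT along the canonical orientation**: `D_{u·v, u·e} = D_{v, e}` (any ring) — the boundary of the cellular
chain complex of the tree commutes with `U(σ, H)`. [cite: SchneiderStuhler1997, III.4] [cite: BruhatTits1972, §10] -/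
theorem incMatrix_latticeGraphIso [DecidableEq {M : Submodule 𝒪[K] (Fin N → K) // IsVertex σ ϖ H M}] (R : Type*) [Ring R]
    {τ : Orientation (latticeGraph σ ϖ H)} (hτ : ∀ e, τ.tail e < τ.head e) (u : unitaryGroupOfForm σ H) (v : {M : Submodule 𝒪[K] (Fin N → K) // IsVertex σ ϖ H M})
    (e : (latticeGraph σ ϖ H).edgeSet) : τ.incMatrix R (latticeGraphIso σ ϖ H u v) ((latticeGraphIso σ ϖ H u).mapEdgeSet e) = τ.incMatrix R v e :=
  NoInversion.incMatrix_map_mapEdgeSet_of_head_mapEdgeSet_eq τ _ R (fun e => (head_mapEdgeSet_latticeGraphIso σ ϖ H hτ u e).1) v e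

/-- **PACKAGE: a `U(σ, H)`-invariant orientation of the lattice graph**, oriented small → big. [cite: Serre1980Trees, I.3.1] [cite: BruhatTits1972, §10] -/
theorem exists_invariant_orientation_latticeGraph :
    ∃ τ : Orientation (latticeGraph σ ϖ H), (∀ e, τ.tail e < τ.head e) ∧
      ∀ (u : unitaryGroupOfForm σ H) (e : (latticeGraph σ ϖ H).edgeSet),
        τ.head ((latticeGraphIso σ ϖ H u).mapEdgeSet e) = latticeGraphIso σ ϖ H u (τ.head e) ∧ τ.tail ((latticeGraphIso σ ϖ H u).mapEdgeSet e) = latticeGraphIso σ ϖ H u (τ.tail e) := by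
  obtain ⟨τ, hτ⟩ := exists_orientation_latticeGraph σ ϖ H
  exact ⟨τ, hτ, fun u e => head_mapEdgeSet_latticeGraphIso σ ϖ H hτ u e⟩

/-! ## §4 `N = 3`: tails are type two, heads are self-dual -/

/-- At `N = 3` over a unimodular form (`σ` valuation-preserving, `ϖ` a uniformiser) the tail of every edge has type `2` and the head is self-dual (★ `type_of_lt_three`).
[cite: BruhatTits1972, §10] -/
theorem type_tail_head_three {σ : K →+* K} (hvσ : ∀ a, Valued.v (σ a) = Valued.v a) {ϖ : K} (hϖ : Valued.v ϖ = WithZero.exp (-1 : ℤ)) {H : Matrix (Fin 3) (Fin 3) K}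
    (hH : Valued.v H.det = 1) {τ : Orientation (latticeGraph σ ϖ H)} (hτ : ∀ e, τ.tail e < τ.head e) (e : (latticeGraph σ ϖ H).edgeSet) {d d' : ℕ}
    (hd : IsVertexLattice σ ϖ H d (τ.tail e).1) (hd' : IsVertexLattice σ ϖ H d' (τ.head e).1) : d = 2 ∧ d' = 0 :=
  type_of_lt_three hvσ hϖ hH hd hd' (Subtype.coe_lt_coe.2 (hτ e))

end Literature.NumberTheory.Automorphic.UnitaryLatticeTree

end
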